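import Literature.AnabelianGeometry.EtaleTheta.Discharge.Sec4Prop42SubUnitRootsAt
import Literature.AnabelianGeometry.EtaleTheta.Discharge.Sec5ConstantUnitNthRoot

/-!
# [EtTh] Thm 5.7 / Lemma 5.8: the per-anchor binder `hsurj` of the Thm 5.7 closer ((L58) «Lemma 5.8 AT the discrepancy
# unit read on `B_N`», GAP row G-f123-1) FOLLOWS from the roots-of-constants law over the pair's domain `A` —
# the SAME law binder that feeds Prop. 4.2 (iv)'s `h₅` (pp. 329–331 / PDF pp. 103–105; Prop 4.2 p.316 / PDF p.90 L14–17)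

S. Mochizuki, *The étale theta function and its Frobenioid-theoretic manifestations*, Publ. RIMS **45** (2009)
[cite: MochizukiEtTh2009, Lem 5.8 p.331 (PDF p.105); Thm 5.7 p.329–330 (PDF pp.103–104); Prop 4.2 p.316 (PDF p.90);
Def 4.1 (iii)(iv) p.313 (PDF p.87)]; S. Mochizuki, *The geometry of Frobenioids I*, Thm. 5.2 (i)/(ii) pp.100–101 (the model
Frobenioid: `Base`, `Div_B`, `O^×(A) ↪ B(A^bs)`; pre-steps are base-isomorphisms).  [cite: MochizukiFrdI2008, Thm. 5.2(ii) p.101]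

abc-iut cell, layer L2, node EtTh:Thm5.7, row «`hsurj` = G-f123-1» (the per-normalised-anchor binder of abc-iut-w6-d077's closer
`ThetaFrobenioidTower.thetaRootPreservedAll_ofConnectedTemperoidYddFamily_final_v3`, p458453; this lineage's residual of record,
`NthRoot.hroot₁N_clause_iff` p455663 / `NthRoot.hroot₁N_iff_exists_root` p442529); seat abc-iut-f-123 gen 5.  PROOF-ONLY (0 defs,
no instance, no new `Prop` fact; nothing landed is edited) over abc-iut-w4-d044's `Discharge/Sec4Prop42SubUnitRootsAt.lean` (p457540:
`Prop42Sub.unitRootsUpstairsAt_of_constantRootsAt`, `Prop42Sub.constantRootsAt_of_def22Reading`) and this lineage's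
`Discharge/Sec5ConstantUnitNthRoot.lean` (`NthRoot.exists_hroot₁N_of_root`).

THE POINT.  In print the `N`-th root of the "constant function" `u` on `B_N` (Thm 5.7 / Lemma 5.8: "`(K^×)^{1/N} ⊆ O^×(B_N^birat)`")
and the `N`-th roots of the pulled-back units of `A_⊙` on `A_N` (Prop 4.2 (iv), p.90 L14–17: «it follows from the
"(N, H_⊙, f|_{A_N})-saturated-ness" condition … that the pull-back … of any element `∈ O^×(A_⊙)` admits an `N`-th root») come from
ONE source: Def 4.1 (iii)(a) — `A_N` is linked by pre-steps `A′ → A_N`, `A′ → A″` to a Frobenius-trivial `(N, H_⊙^{bs-fld})`-saturated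
`A″` — together with the roots-of-constants law at such `A″` ([FrdII] Rmk 2.2.1 + [EtTh] Prop 3.4 (ii)).  abc-iut-w4-d044 typed that
law OVER the pair's domain `A` as the binder `hL` («for Frobenius-trivial `(N, H_⊙^{bs-fld})`-saturated `A″` and `g : A″^bs → A^bs`,
every `Div_B`-trivial `ξ ∈ B(A^bs)` acquires an `N`-th root in `B(A″^bs)` along `g`»; at `A = A_⊙` GAP row G-w4d044-1 verbatim) and
derived Prop 4.2 (iv)'s `h₅` from it.  THIS FILE derives the Thm 5.7 closer's `hsurj` from THE SAME `hL`:
* `BiKummerSetting.exists_root_pull_of_constantRootsLaw` — RAW square lemma (model Frobenioid, `Φ` divisorial, `B` group-like): for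
  ANY commutative square `s″_N ≫ β = α ≫ s″` with `s″_N` a pre-step (so `Base(s″_N)` is an isomorphism), ANY saturation link
  `A′ → A_N`, `A′ → A″` (pre-steps, `A″` Frobenius-trivial `(N, H_⊙^{bs-fld})`-saturated) and ANY unit `u ∈ O^×(B)`:
  `hL` over `A` ⇒ `∃ r ∈ B(B_N^bs)^×, r^N = Base(β)^*(u_u)`.  Route: `ξ := Base(s″)^*(u_u)` is `Div_B`-trivial; the law at `A″` along
  `Base(s₂)⁻¹ ≫ Base(s₁) ≫ Base(α)`; transport back along `Base(s₁)⁻¹ ∘ Base(s₂)` and then along the base-ISOMORPHISM of the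
  pre-step `s″_N`, using `Base(s″_N) ≫ Base(β) = Base(α) ≫ Base(s″)`.
* `BiKummerSetting.NthRoot.exists_root_pull_unit_of_constantRootsAt` — at every `N`-th root `R` of a fraction-pair `(s′, s″) : A → B`
  (Def 4.1 (iv): `R.comm_den`, `R.isSaturated.cond_a`, `R.pair.isPreStep_den`) and every unit `u ∈ O^×(B)`: **(L58) at `(u, N)` ⟸ `hL`
  over `A`** — literally the binder `hsurj` of `…_final_v3` at the rebased root `R̃_N` (abc-iut-f-121's `NthRoot.rebase`, all fields
  `rfl`: `R̃_N.BN = B_N`, `R̃_N.β = β_{1,N}`, pair domain `A_1`).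
* `NthRoot.l58_and_unitRootsUpstairsAt_of_constantRootsAt` — ONE binder, BOTH clauses: `hL` over `A` gives (L58) at every `(u, N)` AND
  abc-iut-w4-d044's `h₅` (`unitRootsUpstairsAt`) at `R` — so in the knit of `…_final_v4` (abc-iut-L2-t4 R480: «h₅-at-R′ ⟸
  `unitRootsUpstairsAt_of_constantRootsAt` = G-w4d044-1 over `A_1`») the binders `hsurj` and `h₅` are fed by the single `hL` over `A_1`:
  **G-f123-1 is REDUNDANT given G-w4d044-1-over-`A_1`**.
* `NthRoot.exists_root_pull_unit_of_def22Reading` — the same at the faithful [FrdII] Def 2.2 (ii) reading (`ctx`, `hNH`, Rmk 2.2.1's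
  `PadicKummer.SaturatedInvariantsAdmitRoots` `h221` — PROVED at the arithmetic contexts, layer L1 — `ιO`, `hconst`), via
  abc-iut-w4-d044's `constantRootsAt_of_def22Reading`.
* `BiKummerSetting.hsurj_of_constantRootsAt_family` — FAMILY / TOWER form over any family of roots `(R N)_N` of one pair with
  transitions `a_N : A_N → A_1`, `b_N : B_N → B_1` commuting with the denominators (`s″_N ≫ b_N = a_N ≫ s″_1`, the tower's `comm_sCup`
  at `(1, N)`): for EVERY unit `u₁ ∈ O^×(B_1)` and EVERY `N`, `∃ r ∈ B(B_N^bs)^×, r^N = Base(b_N)^*(u_{u₁})` — the conclusion of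
  `…_final_v3`'s `hsurj` VERBATIM (its anchor hypotheses `hnum`/`hden` are not needed), from `hL` over `A_1` and [FrdI] Thm 5.2's
  hypotheses `h` (`Φ` divisorial, `B` group-like).
* `NthRoot.exists_hroot₁N_of_constantRootsAt` — at settings satisfying [FrdI] Thm 5.2's hypotheses `h` with `Φ` perfect (the genuine
  `mkOfConnectedTemperoid(YddTower)`), the ORIGINAL binder `hroot₁N` (a unit `ũ ∈ O^×(B_N)` OVER `u` along `β`) ⟸ `hL` over `A`
  (this lineage's `exists_hroot₁N_of_root`, p442529, fed by the root just produced).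
CENSUS WORDING (EtTh:Thm5.7): «`hsurj` ((L58) at the discrepancy unit, G-f123-1) ⟸ the roots-of-constants law over `A_1` — the same
binder `hL` that supplies `hivPiso`'s `h₅`; at the Def 2.2 reading ⟸ [FrdII] Rmk 2.2.1 (theorem at the arithmetic contexts) + `hconst`».
HONEST FRAMING: kernel-checked [FrdI]/[EtTh] §4 bookkeeping over the typed structures; the law `hL` itself is NOT discharged here
(GAP row G-w4d044-1 / its Def 2.2 reading of record); refereed pre-IUT material; nothing here bears on [IUTchIII] Cor. 3.12 or takes a
side; typed ≠ proved for the genuine datum.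
-/

namespace Literature.AnabelianGeometry.EtaleTheta

open CategoryTheory Opposite Literature.AlgebraicGeometry.Frobenioids

universe u₀ v₀ u v w

variable {K : Type u₀} [Field K]

namespace BiKummerSetting

variable {X : SemiGraphs.TemperedArithmeticGroup.{u₀} K} {D₀ : Type u₀} [Category.{v₀} D₀]
  {V : FrdIMonoidStub.{w}} {T : RealifiedDivisorMonoids (D₀ := D₀) V} {D : Type u} [Category.{v} D]
  {VD : FrdICatStub.{u, v, w} D} (S : BiKummerSetting X T D VD)

/-! ## §1. The raw square lemma in the model Frobenioid -/

/-- **Roots of a pulled-back unit across a square with a pre-step** ([FrdI] Thm 5.2 (ii); [EtTh] Def 4.1 (iii)(a), Lemma 5.8):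
`Φ` divisorial, `B` group-like; a square `s″_N ≫ β = α ≫ s″` in `C` (`s″ : A → B`, `β : B_N → B`, `α : A_N → A`,
`s″_N : A_N → B_N` a PRE-STEP); pre-steps `s₁ : A′ → A_N`, `s₂ : A′ → A″` with `A″` Frobenius-trivial and
`(N, H_⊙^{bs-fld})`-saturated; the roots-of-constants law `hL` over `A`.  Then for every unit `u ∈ O^×(B)` the pulled-back unit
function `Base(β)^*(u_u) ∈ B(B_N^bs)` is an `N`-th power of a unit of `B(B_N^bs)`.
[cite: MochizukiEtTh2009, Lem 5.8 p.331 (PDF p.105)] -/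
theorem exists_root_pull_of_constantRootsLaw
    (hΦd : Objectwise (fun M _ => IsDivisorial M) S.tf.divisorMonoid)
    (hBg : Objectwise (fun M _ => IsGroupLike M) S.tf.ratFnFunctor) {A B AN BN : S.C} {N : ℕ+}
    (hL : ∀ (A'' : S.C) (N : ℕ+) (g : A''.base ⟶ A.base) (ξ : S.tf.ratFnFunctor.obj (op A.base)),
      S.IsFrobeniusTrivial A'' → S.IsNHSaturatedBsFld S.HodotBsFld A'' N →
      divB S.tf.divisorMonoid S.tf.ratFnFunctor S.tf.divBNatTrans (op A.base) ξ = 1 →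
        ∃ ζ : S.tf.ratFnFunctor.obj (op A''.base), ζ ^ (N : ℕ) = pull S.tf.ratFnFunctor g ξ)
    (s'' : A ⟶ B) (β : BN ⟶ B) (α : AN ⟶ A) (s''N : AN ⟶ BN) (hs''N : S.IsPreStep s''N)
    (comm : s''N ≫ β = α ≫ s'') {A' A'' : S.C} (s₁ : A' ⟶ AN) (s₂ : A' ⟶ A'') (hs₁ : S.IsPreStep s₁)
    (hs₂ : S.IsPreStep s₂) (hft : S.IsFrobeniusTrivial A'') (hNH : S.IsNHSaturatedBsFld S.HodotBsFld A'' N)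
    (u : Aut B) (hu : u ∈ S.units B) :
    ∃ r : (S.tf.ratFnFunctor.obj (op BN.base))ˣ, (r : S.tf.ratFnFunctor.obj (op BN.base)) ^ (N : ℕ) =
      pull S.tf.ratFnFunctor (ModelFrobenioid.baseMap β) (ModelFrobenioid.unit u.hom) := by
  haveI : IsIso (ModelFrobenioid.baseMap s₁) := hs₁.2
  haveI : IsIso (ModelFrobenioid.baseMap s₂) := hs₂.2
  haveI : IsIso (ModelFrobenioid.baseMap s''N) := hs''N.2
  have hum : u ∈ ModelFrobenioid.units B := ⟨hu.1, hu.2⟩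
  -- the square on bases: `Base(s″_N) ≫ Base(β) = Base(α) ≫ Base(s″)`
  have hsq : ModelFrobenioid.baseMap s''N ≫ ModelFrobenioid.baseMap β =
      ModelFrobenioid.baseMap α ≫ ModelFrobenioid.baseMap s'' := by
    rw [← ModelFrobenioid.baseMap_comp, comm, ModelFrobenioid.baseMap_comp]
  -- `ξ := Base(s″)^*(u_u) ∈ B(A^bs)` is `Div_B`-trivial (`u` is a unit, `Φ` sharp; naturality of `Div_B`)
  have hu1 : divB S.tf.divisorMonoid S.tf.ratFnFunctor S.tf.divBNatTrans (op B.base) (ModelFrobenioid.unit u.hom) = 1 :=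
    ModelFrobenioid.divB_unitsToRatFn_eq_one (hΦd B.base).isSharp ⟨u, hum⟩
  set ξ := pull S.tf.ratFnFunctor (ModelFrobenioid.baseMap s'') (ModelFrobenioid.unit u.hom) with hξ_def
  have hξ : divB S.tf.divisorMonoid S.tf.ratFnFunctor S.tf.divBNatTrans (op A.base) ξ = 1 := by
    rw [hξ_def, ← ModelFrobenioid.pullGp_divB_pull, hu1, map_one]
  -- the law at `A″` along `g := Base(s₂)⁻¹ ≫ Base(s₁) ≫ Base(α)`
  obtain ⟨ζ, hζ⟩ := hL A'' N (inv (ModelFrobenioid.baseMap s₂) ≫ ModelFrobenioid.baseMap s₁ ≫ ModelFrobenioid.baseMap α)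
    ξ hft hNH hξ
  -- transport `ζ` to `B(B_N^bs)` along `Base(s₁)⁻¹ ∘ Base(s₂)` and the base-isomorphism of the pre-step `s″_N`
  set r₀ : S.tf.ratFnFunctor.obj (op BN.base) :=
    pull S.tf.ratFnFunctor (inv (ModelFrobenioid.baseMap s''N))
      (pull S.tf.ratFnFunctor (inv (ModelFrobenioid.baseMap s₁)) (pull S.tf.ratFnFunctor (ModelFrobenioid.baseMap s₂) ζ))
    with hr₀_def
  have hr₀N : r₀ ^ (N : ℕ) = pull S.tf.ratFnFunctor (ModelFrobenioid.baseMap β) (ModelFrobenioid.unit u.hom) := by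
    rw [hr₀_def, ← map_pow, ← map_pow, ← map_pow, hζ, ← pull_comp, ← pull_comp, ← pull_comp, Category.assoc,
      Category.assoc, IsIso.hom_inv_id_assoc, IsIso.inv_hom_id_assoc, hξ_def, ← pull_comp, Category.assoc, ← hsq,
      IsIso.inv_hom_id_assoc]
  obtain ⟨r, hr⟩ := (hBg BN.base).isUnit r₀
  exact ⟨r, by rw [hr, hr₀N]⟩

/-! ## §2. At an `N`-th root of a fraction-pair: (L58) at `(u, N)` ⟸ the law over the pair's domain -/

namespace NthRoot

variable {S}
variable {pullFrac : ∀ {A A' : S.C} (_ : A' ⟶ A), S.biratUnits A → S.biratUnits A'}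
  {A B : S.C} {f : S.biratUnits A} {P : S.FractionPair f B} {N : ℕ+} (R : S.NthRoot f P N pullFrac)

/-- **(L58) at `(u, N)` ⟸ the roots-of-constants law over the pair's domain `A`** ([EtTh] Lemma 5.8 "`(K^×)^{1/N} ⊆ O^×(B_N^birat)`"
at the unit `u`, read on `B_N`; Def 4.1 (iii)(a)/(iv); [FrdI] Thm 5.2 (ii)): for every `N`-th root `R = (A_N, B_N, α, β, …)` of a
fraction-pair `(s′, s″) : A → B` and every unit `u ∈ O^×(B)`, the law `hL` over `A` (abc-iut-w4-d044's binder of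
`Prop42Sub.unitRootsUpstairsAt_of_constantRootsAt`) yields `r ∈ B(B_N^bs)^×` with `r^N = Base(β)^*(u_u)` — the clause `hsurj` of the
Thm 5.7 closer `…_final_v3` at `(u, N)` (apply to the rebased root `R̃_N`, whose `BN`, `β` are `B_N`, `β_{1,N}` by `rfl`).
[cite: MochizukiEtTh2009, Lem 5.8 p.331 (PDF p.105)] -/
theorem exists_root_pull_unit_of_constantRootsAt
    (hΦd : Objectwise (fun M _ => IsDivisorial M) S.tf.divisorMonoid)
    (hBg : Objectwise (fun M _ => IsGroupLike M) S.tf.ratFnFunctor)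
    (hL : ∀ (A'' : S.C) (N : ℕ+) (g : A''.base ⟶ A.base) (ξ : S.tf.ratFnFunctor.obj (op A.base)),
      S.IsFrobeniusTrivial A'' → S.IsNHSaturatedBsFld S.HodotBsFld A'' N →
      divB S.tf.divisorMonoid S.tf.ratFnFunctor S.tf.divBNatTrans (op A.base) ξ = 1 →
        ∃ ζ : S.tf.ratFnFunctor.obj (op A''.base), ζ ^ (N : ℕ) = pull S.tf.ratFnFunctor g ξ)
    (u : Aut B) (hu : u ∈ S.units B) :
    ∃ r : (S.tf.ratFnFunctor.obj (op R.BN.base))ˣ, (r : S.tf.ratFnFunctor.obj (op R.BN.base)) ^ (N : ℕ) =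
      pull S.tf.ratFnFunctor (ModelFrobenioid.baseMap R.β) (ModelFrobenioid.unit u.hom) := by
  obtain ⟨A₁, A'', s₁, s₂, hs₁, hs₂, hft, hNH⟩ := R.isSaturated.cond_a
  exact S.exists_root_pull_of_constantRootsLaw hΦd hBg hL P.den R.β R.α R.pair.den R.pair.isPreStep_den R.comm_den s₁ s₂ hs₁
    hs₂ hft hNH u hu

/-- **ONE binder, BOTH clauses**: the roots-of-constants law `hL` over the pair's domain `A` yields, at every `N`-th root `R`, BOTH
(L58) at every unit `u ∈ O^×(B)` (the Thm 5.7 closer's `hsurj`) AND Prop 4.2 (iv)'s `h₅` — abc-iut-w4-d044's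
`Prop42Sub.unitRootsUpstairsAt_of_constantRootsAt` (every unit of `A_N` over a unit of `A` along `α′` is an `N`-th power in
`O^×(A_N)`).  [cite: MochizukiEtTh2009, Prop 4.2 p.316 (PDF p.90)] -/
theorem l58_and_unitRootsUpstairsAt_of_constantRootsAt
    (hΦd : Objectwise (fun M _ => IsDivisorial M) S.tf.divisorMonoid)
    (hBg : Objectwise (fun M _ => IsGroupLike M) S.tf.ratFnFunctor)
    (hL : ∀ (A'' : S.C) (N : ℕ+) (g : A''.base ⟶ A.base) (ξ : S.tf.ratFnFunctor.obj (op A.base)),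
      S.IsFrobeniusTrivial A'' → S.IsNHSaturatedBsFld S.HodotBsFld A'' N →
      divB S.tf.divisorMonoid S.tf.ratFnFunctor S.tf.divBNatTrans (op A.base) ξ = 1 →
        ∃ ζ : S.tf.ratFnFunctor.obj (op A''.base), ζ ^ (N : ℕ) = pull S.tf.ratFnFunctor g ξ) :
    (∀ (u : Aut B), u ∈ S.units B →
      ∃ r : (S.tf.ratFnFunctor.obj (op R.BN.base))ˣ, (r : S.tf.ratFnFunctor.obj (op R.BN.base)) ^ (N : ℕ) =
        pull S.tf.ratFnFunctor (ModelFrobenioid.baseMap R.β) (ModelFrobenioid.unit u.hom)) ∧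
    ∀ (x : Aut A) (x' : Aut R.AN), x ∈ S.units A → x' ∈ S.units R.AN →
      x'.hom ≫ R.αData.α₁ = R.αData.α₁ ≫ x.hom → ∃ y ∈ S.units R.AN, y ^ (N : ℕ) = x' :=
  ⟨fun u hu => R.exists_root_pull_unit_of_constantRootsAt hΦd hBg hL u hu,
    Prop42Sub.unitRootsUpstairsAt_of_constantRootsAt S pullFrac hΦd hBg hL f P N R⟩

/-- **(L58) at `(u, N)` AT THE FAITHFUL [FrdII] Def 2.2 (ii) READING** of the saturation slot: ⟸ the reading law `hNH`, [FrdII]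
Rmk 2.2.1's `PadicKummer.SaturatedInvariantsAdmitRoots (ctx A″) N` for the Frobenius-trivial `A″` over `A` (`h221`; a theorem at
the arithmetic contexts, layer L1), a monoid map `ιO A″ : O^□(A″) → B(A″^bs)` and the clause `hconst` «the pull-back to `A″` of a
`Div_B`-trivial element of `B(A^bs)` is the image of an `(H_⊙)_{A″}`-invariant element» — via abc-iut-w4-d044's
`Prop42Sub.constantRootsAt_of_def22Reading`.  [cite: MochizukiEtTh2009, Lem 5.8 p.331 (PDF p.105)] -/
theorem exists_root_pull_unit_of_def22Reading
    (hΦd : Objectwise (fun M _ => IsDivisorial M) S.tf.divisorMonoid)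
    (hBg : Objectwise (fun M _ => IsGroupLike M) S.tf.ratFnFunctor) (ctx : S.C → PadicKummer.Def22Context)
    (hNH : ∀ (A'' : S.C) (N : ℕ+),
      S.IsNHSaturatedBsFld S.HodotBsFld A'' N → PadicKummer.IsNHSaturated (ctx A'') N)
    (h221 : ∀ (A'' : S.C) (N : ℕ+), (A''.base ⟶ A.base) → S.IsFrobeniusTrivial A'' →
      PadicKummer.SaturatedInvariantsAdmitRoots (ctx A'') N)
    (ιO : ∀ A'' : S.C, (ctx A'').O →* S.tf.ratFnFunctor.obj (op A''.base))
    (hconst : ∀ (A'' : S.C) (g : A''.base ⟶ A.base) (ξ : S.tf.ratFnFunctor.obj (op A.base)),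
      S.IsFrobeniusTrivial A'' →
      divB S.tf.divisorMonoid S.tf.ratFnFunctor S.tf.divBNatTrans (op A.base) ξ = 1 →
        ∃ f : (ctx A'').O, (∀ h : (ctx A'').HA, (h : (ctx A'').AutE) • f = f) ∧
          ιO A'' f = pull S.tf.ratFnFunctor g ξ)
    (u : Aut B) (hu : u ∈ S.units B) :
    ∃ r : (S.tf.ratFnFunctor.obj (op R.BN.base))ˣ, (r : S.tf.ratFnFunctor.obj (op R.BN.base)) ^ (N : ℕ) =
      pull S.tf.ratFnFunctor (ModelFrobenioid.baseMap R.β) (ModelFrobenioid.unit u.hom) :=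
  R.exists_root_pull_unit_of_constantRootsAt hΦd hBg
    (Prop42Sub.constantRootsAt_of_def22Reading S ctx hNH h221 ιO hconst) u hu

end NthRoot

/-! ## §3. Family / tower form: the conclusion of `…_final_v3`'s `hsurj` verbatim, for every unit of `B_1` and every level -/

/-- **`hsurj` OF THE Thm 5.7 CLOSER, FAMILY FORM** (Rmk 4.3.2 compatible systems; Lemma 5.8 at each level): for a family of roots
`(R N)_N` of one fraction-pair with transitions `a_N : A_N → A_1`, `b_N : B_N → B_1` over the level-`1` root commuting with the
denominators (`s″_N ≫ b_N = a_N ≫ s″_1` — the tower's `comm_sCup` at `(1, N)`), under [FrdI] Thm 5.2's hypotheses `h` (so `Φ` is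
divisorial and `B` group-like) and the roots-of-constants law `hL` over `A_1 := (R 1).AN`: for EVERY unit `u₁ ∈ O^×(B_1)` and EVERY
level `N` there is `r ∈ B(B_N^bs)^×` with `r^N = Base(b_N)^*(u_{u₁})` — the conclusion of the binder `hsurj` of
`ThetaFrobenioidTower.thetaRootPreservedAll_ofConnectedTemperoidYddFamily_final_v3` VERBATIM (instantiate `a_N := α (one_dvd_level N)`,
`b_N := β (one_dvd_level N)`, `comm := comm_sCup (one_dvd_level N)`; the normalisation hypotheses `hnum`, `hden` of that binder are
not used).  [cite: MochizukiEtTh2009, Thm 5.7 p.329–330 (PDF pp.103–104)] -/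
theorem hsurj_of_constantRootsAt_family (h : ModelFrobenioid.Hypotheses S.tf.divisorMonoid S.tf.ratFnFunctor)
    {pullFrac : ∀ {A A' : S.C} (_ : A' ⟶ A), S.biratUnits A → S.biratUnits A'} {A B : S.C} {f : S.biratUnits A}
    {P : S.FractionPair f B} (R : ∀ N : ℕ+, S.NthRoot f P N pullFrac) (a : ∀ N : ℕ+, (R N).AN ⟶ (R 1).AN)
    (b : ∀ N : ℕ+, (R N).BN ⟶ (R 1).BN) (comm : ∀ N : ℕ+, (R N).pair.den ≫ b N = a N ≫ (R 1).pair.den)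
    (hL : ∀ (A'' : S.C) (N : ℕ+) (g : A''.base ⟶ (R 1).AN.base) (ξ : S.tf.ratFnFunctor.obj (op (R 1).AN.base)),
      S.IsFrobeniusTrivial A'' → S.IsNHSaturatedBsFld S.HodotBsFld A'' N →
      divB S.tf.divisorMonoid S.tf.ratFnFunctor S.tf.divBNatTrans (op (R 1).AN.base) ξ = 1 →
        ∃ ζ : S.tf.ratFnFunctor.obj (op A''.base), ζ ^ (N : ℕ) = pull S.tf.ratFnFunctor g ξ) :
    ∀ (u₁ : Aut (R 1).BN), u₁ ∈ S.units (R 1).BN → ∀ N : ℕ+,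
      ∃ r : S.tf.biratUnitsModel (R N).BN, (r : S.tf.ratFnFunctor.obj (op (R N).BN.base)) ^ (N : ℕ) =
        (S.tf.ratFnFunctor.map (ModelFrobenioid.baseMap (b N)).op).hom (ModelFrobenioid.unit u₁.hom) := by
  intro u₁ hu₁ N
  obtain ⟨A₁, A'', s₁, s₂, hs₁, hs₂, hft, hNH⟩ := (R N).isSaturated.cond_a
  exact S.exists_root_pull_of_constantRootsLaw h.isDivisorial h.isGroupLike_rat hL (R 1).pair.den (b N) (a N) (R N).pair.den
    (R N).pair.isPreStep_den (comm N) s₁ s₂ hs₁ hs₂ hft hNH u₁ hu₁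

/-! ## §4. Back to the original binder `hroot₁N`: a unit of `B_N` OVER `u` along `β`, from the law alone (genuine-type settings) -/

namespace NthRoot

variable {S}
variable {pullFrac : ∀ {A A' : S.C} (_ : A' ⟶ A), S.biratUnits A → S.biratUnits A'}
  {A B : S.C} {f : S.biratUnits A} {P : S.FractionPair f B} {N : ℕ+} (R : S.NthRoot f P N pullFrac)

/-- **`hroot₁N` ⟸ the roots-of-constants law over `A`** at every setting whose tempered Frobenioid satisfies [FrdI] Thm 5.2's
hypotheses `h` with `Φ` perfect `hP` (abc-iut-L2-t4's genuine `mkOfConnectedTemperoid(YddTower)`): for every `N`-th root `R` of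
`(s′, s″) : A → B` and every unit `u ∈ O^×(B)` there is `ũ ∈ O^×(B_N)` with `ũ ≫ β = β ≫ u` (this lineage's
`exists_hroot₁N_of_root`, p442529, fed by `exists_root_pull_unit_of_constantRootsAt`).  [cite: MochizukiEtTh2009, Lem 5.8 p.331 (PDF p.105)] -/
theorem exists_hroot₁N_of_constantRootsAt (h : ModelFrobenioid.Hypotheses S.tf.divisorMonoid S.tf.ratFnFunctor)
    (hP : ∀ A : Dᵒᵖ, IsPerfect (S.tf.Φ.carrier A))
    (hL : ∀ (A'' : S.C) (N : ℕ+) (g : A''.base ⟶ A.base) (ξ : S.tf.ratFnFunctor.obj (op A.base)),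
      S.IsFrobeniusTrivial A'' → S.IsNHSaturatedBsFld S.HodotBsFld A'' N →
      divB S.tf.divisorMonoid S.tf.ratFnFunctor S.tf.divBNatTrans (op A.base) ξ = 1 →
        ∃ ζ : S.tf.ratFnFunctor.obj (op A''.base), ζ ^ (N : ℕ) = pull S.tf.ratFnFunctor g ξ)
    (u : Aut B) (hu : u ∈ S.units B) :
    ∃ ut : Aut R.BN, ut ∈ S.units R.BN ∧ ut.hom ≫ R.β = R.β ≫ u.hom := by
  obtain ⟨r, hr⟩ := R.exists_root_pull_unit_of_constantRootsAt h.isDivisorial h.isGroupLike_rat hL u hu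
  obtain ⟨ut, hut, -, hover⟩ := R.exists_hroot₁N_of_root h hP u hu r hr
  exact ⟨ut, hut, hover⟩

end NthRoot

end BiKummerSetting

end Literature.AnabelianGeometry.EtaleTheta
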